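import Literature.AlgebraicGeometry.Resolution.PrimeDivisorIdeals
import Literature.AlgebraicGeometry.Resolution.AlterationsLemma32
import Literature.AlgebraicGeometry.Dimension.FibreLocalRingDimension
import Literature.AlgebraicGeometry.Motives.BettiCycleClassProofs
import Literature.AlgebraicGeometry.Motives.AbelianVarietyIsogenyProofs
import Literature.AlgebraicGeometry.Motives.CyclesPushforwardFacts
import Mathlib.AlgebraicGeometry.Morphisms.Finite
import Mathlib.AlgebraicGeometry.Morphisms.Smooth
import HarnessLib

/-!
# The image of a finite morphism from an integral `d`-fold into a smooth `(d+1)`-fold has locally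
principal ideal

Crux `WeightedThesis` (stmt-ResolutionOfSingularities-0569), line `datum-glued-split`, stub C
(`stub_imageLocallyPrincipal`).

Let `k` be a field, `Y` an integral scheme smooth over `k` of dimension `d + 1`, `X'` an integral
scheme of dimension `d` and `Φ : X' → Y` a finite morphism. Then the kernel ideal sheaf `ker Φ`
(the ideal of the scheme-theoretic image `H = Φ(X')`) is locally principal: every point of `Y` has
an affine open neighbourhood `U` with `(ker Φ)(U)` a principal ideal of `Γ(Y, U)`.

Proof. `X'` is reduced, so `ker Φ` is the vanishing ideal sheaf of `closure (range Φ)`, which is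
`closure {ζ}` for `ζ = Φ(η)` the image of the generic point (`ker_eq_primeDivisorIdeal`). The
morphism `X' → H` onto the scheme-theoretic image is finite and surjective (dominant and closed),
so `dim H = dim X' = d` (the tree's `topologicalKrullDim_eq_of_isFinite_of_surjective`,
Stacks 0ECG), and the generic point of `H` is `ζ`; hence `height ζ = d` in the specialisation
order of `Y`, and `coheight ζ = 1` by `dim 𝒪_{Y,ζ} + dim closure {ζ} = dim Y`
(`coheight_add_height_eq_topologicalKrullDim`, Görtz–Wedhorn I Thm. 5.22). Finally `Y` is
regular (smooth over a field, EGA IV 17.5.8 (iii)) and locally Noetherian, so the prime divisor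
`closure {ζ}` is an effective Cartier divisor (`isEffectiveCartier_primeDivisorIdeal_of_isRegular`:
Auslander–Buchsbaum, height-one primes of factorial local rings are principal; Görtz–Wedhorn I,
Thm. 11.40 (2); Hartshorne II, Prop. 6.11), in particular its ideal is locally principal.

References: U. Görtz, T. Wedhorn, *Algebraic Geometry I*, 2nd ed. (2020), Thm. 11.40 (2);
R. Hartshorne, *Algebraic Geometry* (1977), II Prop. 6.2 and 6.11; Stacks Project, Tag 0ECG.
-/

noncomputable section

set_option linter.dupNamespace false -- mandated namespace of this single-conjunct summit

open CategoryTheory CategoryTheory.Limits AlgebraicGeometry TopologicalSpace Order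
open Literature.AlgebraicGeometry.Resolution

namespace Summit.ResolutionOfSingularities.ResolutionOfSingularities.Theorems.WeightedThesis.HypersurfaceModel

universe u

variable {X' Y : Scheme.{u}}

/-- For a finite morphism `Φ`, the morphism `X' → Φ(X')` onto the scheme-theoretic image is
finite (it is followed by the separated closed immersion `Φ(X') ↪ Y`, with finite composite
`Φ`). [folklore] -/
theorem isFinite_toImage (Φ : X' ⟶ Y) [IsFinite Φ] : IsFinite Φ.toImage :=
  haveI : IsFinite (Φ.toImage ≫ Φ.imageι) := by rw [Scheme.Hom.toImage_imageι]; infer_instance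
  IsFinite.of_comp Φ.toImage Φ.imageι

/-- For a finite morphism `Φ`, the morphism `X' → Φ(X')` onto the scheme-theoretic image is
surjective: it is dominant and closed. [folklore] -/
theorem surjective_toImage (Φ : X' ⟶ Y) [IsFinite Φ] : Surjective Φ.toImage := by
  haveI := isFinite_toImage Φ
  have h : closure (Set.range Φ.toImage) = Set.univ := Φ.toImage.denseRange.closure_range
  rw [Φ.toImage.isClosedMap.isClosed_range.closure_eq] at h
  exact ⟨fun y => (Set.eq_univ_iff_forall.mp h) y⟩

/-- **Finite morphisms preserve dimension onto their image**: for `Φ : X' → Y` finite, the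
scheme-theoretic image `Φ(X')` has the dimension of `X'` (Stacks 0ECG; Görtz–Wedhorn I,
Prop. 12.12). [cite: StacksProject, Tag 0ECG (Lemma 29.45.9)] -/
theorem topologicalKrullDim_image (Φ : X' ⟶ Y) [IsFinite Φ] :
    topologicalKrullDim Φ.image = topologicalKrullDim X' := by
  haveI := isFinite_toImage Φ
  haveI := surjective_toImage Φ
  exact
    (Literature.AlgebraicGeometry.Motives.Scheme.topologicalKrullDim_eq_of_isFinite_of_surjective
      Φ.toImage).symm

/-- For `Φ : X' → Y` finite with `X'` integral, the image `ζ = Φ(η)` of the generic point has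
`dim closure {ζ} = dim X'`, i.e. `height ζ = dim X'` in the specialisation order of `Y`: `ζ` is
the generic point of the integral closed subscheme `Φ(X')`, of dimension `dim X'`. [folklore] -/
theorem height_apply_genericPoint [IsIntegral X'] (Φ : X' ⟶ Y) [IsFinite Φ] :
    (height (Φ (genericPoint X')) : WithBot ℕ∞) = topologicalKrullDim X' := by
  haveI : IsIntegral Φ.image :=
    Literature.AlgebraicGeometry.Motives.isIntegral_image_of_isIntegral Φ
  have h1 : Φ (genericPoint X') = Φ.imageι (Φ.toImage (genericPoint X')) := by
    rw [← Scheme.Hom.comp_apply, Scheme.Hom.toImage_imageι]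
  rw [h1, genericPoint_eq_of_isDominant Φ.toImage,
    Literature.AlgebraicGeometry.Motives.Scheme.height_base_eq_of_isClosedImmersion,
    Literature.AlgebraicGeometry.Motives.Scheme.height_genericPoint, topologicalKrullDim_image]

/-- **Codimension one.** For `Φ : X' → Y` finite, `X'` integral of dimension `d`, `Y` integral,
locally of finite type over a field, of dimension `d + 1`, the point `ζ = Φ(η)` has codimension
one: `dim 𝒪_{Y,ζ} = dim Y - dim closure {ζ} = (d + 1) - d` (Görtz–Wedhorn I, Thm. 5.22 /
Hartshorne II Ex. 3.20). [cite: GortzWedhorn2020, Thm. 5.22] -/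
theorem coheight_apply_genericPoint_eq_one {k : Type u} [Field k] [IsIntegral X'] [IsIntegral Y]
    (gY : Y ⟶ Spec (.of k)) [LocallyOfFiniteType gY] (Φ : X' ⟶ Y) [IsFinite Φ] {d : ℕ}
    (hX' : topologicalKrullDim X' = d) (hY : topologicalKrullDim Y = (d + 1 : ℕ)) :
    coheight (Φ (genericPoint X')) = 1 := by
  have h := Literature.AlgebraicGeometry.Dimension.coheight_add_height_eq_topologicalKrullDim gY
    (Φ (genericPoint X'))
  rw [hY] at h
  have hh := height_apply_genericPoint Φ
  rw [hX'] at hh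
  have hh' : height (Φ (genericPoint X')) = (d : ℕ∞) := by exact_mod_cast hh
  have h' : coheight (Φ (genericPoint X')) + height (Φ (genericPoint X')) =
      ((d + 1 : ℕ) : ℕ∞) := by
    exact_mod_cast h
  rw [hh', Nat.cast_add, Nat.cast_one, add_comm (d : ℕ∞) 1] at h'
  exact WithTop.add_right_cancel (ENat.coe_ne_top d) h'

/-- **The kernel of a morphism from an integral scheme is the ideal sheaf of the prime cycle
`closure {Φ(η)}`**: `X'` being reduced, `ker Φ` is the vanishing ideal sheaf of
`closure (range Φ) = closure {Φ(η)}`. [folklore] -/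
theorem ker_eq_primeDivisorIdeal [IsIntegral X'] (Φ : X' ⟶ Y) :
    Φ.ker = primeDivisorIdeal (Φ (genericPoint X')) := by
  rw [ker_eq_vanishingIdeal_of_isReduced Φ, primeDivisorIdeal]
  congr 1
  ext1
  change closure (Set.range Φ) = closure {Φ (genericPoint X')}
  apply le_antisymm
  · refine closure_minimal ?_ isClosed_closure
    rintro _ ⟨x, rfl⟩
    exact ((genericPoint_specializes x).map Φ.continuous).mem_closure
  · exact closure_mono (Set.singleton_subset_iff.mpr ⟨_, rfl⟩)

/-- **The image of a finite morphism from an integral `d`-fold to a smooth `(d+1)`-fold has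
locally principal ideal.** For `Φ : X' → Y` finite, `X'` integral of dimension `d`, `Y` integral,
smooth over a field `k`, of dimension `d + 1`: every point of `Y` has an affine open neighbourhood
on which the kernel ideal sheaf of `Φ` is principal — `Y` is regular (smooth over a field) and
locally Noetherian, `ker Φ` is the ideal sheaf of the prime divisor `closure {Φ(η)}`
(`coheight Φ(η) = 1`), and prime divisors on regular schemes are effective Cartier divisors
(Auslander–Buchsbaum). [cite: GortzWedhorn2020, Thm. 11.40 (2)] -/
theorem imageLocallyPrincipal {k : Type u} [Field k] [IsIntegral X'] [IsIntegral Y]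
    (gY : Y ⟶ Spec (.of k)) [Smooth gY] (Φ : X' ⟶ Y) [IsFinite Φ] {d : ℕ}
    (hX' : topologicalKrullDim X' = d) (hY : topologicalKrullDim Y = (d + 1 : ℕ)) (y : Y) :
    ∃ U : Y.affineOpens, y ∈ (U : Y.Opens) ∧ (Φ.ker.ideal U).IsPrincipal := by
  haveI : IsLocallyNoetherian Y := LocallyOfFiniteType.isLocallyNoetherian gY
  have hreg : Scheme.IsRegular Y :=
    Scheme.IsRegular.of_smooth gY (Scheme.isRegular_Spec (.of k))
  have hζ := coheight_apply_genericPoint_eq_one gY Φ hX' hY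
  obtain ⟨U, hyU, f, -, hf⟩ := isEffectiveCartier_primeDivisorIdeal_of_isRegular hreg hζ y
  exact ⟨U, hyU, ⟨f, by rw [ker_eq_primeDivisorIdeal Φ, hf]⟩⟩

/-- STUB C of the crux skeleton, verbatim: **the image of a finite morphism from an integral
`d`-fold to a smooth `(d+1)`-fold over a field has locally principal kernel ideal sheaf**
(`imageLocallyPrincipal`). [cite: GortzWedhorn2020, Thm. 11.40 (2)] -/
theorem stub_imageLocallyPrincipal :
    ∀ (k : Type) [Field k] (X' Y : AlgebraicGeometry.Scheme.{0}) [AlgebraicGeometry.IsIntegral X']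
      [AlgebraicGeometry.IsIntegral Y] (gY : Y ⟶ AlgebraicGeometry.Spec (.of k))
      [AlgebraicGeometry.Smooth gY] (Φ : X' ⟶ Y) [AlgebraicGeometry.IsFinite Φ] (d : ℕ),
      topologicalKrullDim X' = d → topologicalKrullDim Y = (d + 1 : ℕ) →
      ∀ y : Y, ∃ U : Y.affineOpens, y ∈ (U : Y.Opens) ∧ (Φ.ker.ideal U).IsPrincipal :=
  fun _ _ _ _ _ _ gY _ Φ _ _ hX' hY y => imageLocallyPrincipal gY Φ hX' hY y

end Summit.ResolutionOfSingularities.ResolutionOfSingularities.Theorems.WeightedThesis.HypersurfaceModel
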